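import Literature.NumberTheory.ComplexMultiplication.CosetGermGaloisOrbitTori
import HarnessLib

/-!
# Milne 1999 §6 THEOREM 6.1 at level `K`, read on characters, WITH THE CM FIELD `K`'S OWN FOUR VERTICES: `X^*(T^K)(K) → X^*(L^K)(K) ⊕
# X^*(S^K)(K) → X^*(P^K)(K)` is exact — `X^*(T^K) = X^*(∏_Ψ (T^Ψ, t^Ψ))`, `X^*(L^K) = X^*(∏_Π (L^Π, l^Π))` built from `K`'s own orbit tori

(J. S. Milne, *Lefschetz motives and the Tate conjecture*, Compositio Math. 117 (1999) 45–76, §1 p. 48, Thm 2.6 p. 56, §4 p. 62, §6 pp. 66, 68, 71–72).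

Family `hodge`, lane `lit-hodgefound` (Layer A3; seat `lit-hodgefound-p27`, generation 18, row g18-#7); topic `Literature/NumberTheory/
ComplexMultiplication`; namespaces `….PairProduct`/`….OrbitTorus`/`….CosetGerm` (§0, generic) and `….CMNumbers` (§§1–7).  Sequel of g18-#6
`CosetGermGaloisOrbitTori` (per orbit, `K`'s `X^*(T^Ψ)`, `X^*(L^Π)`, `γ`, `β`, `α″` ARE the model's).  DEFINITIONS WITH BODIES + THEOREMS, no named
fact (D-0026, net debt 0).  NOT a case of the Hodge conjecture; THEOREM 6.1 on group schemes / the limit over `K` is Layer B (B5-09), not claimed.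

THE PRINT.  §1 p. 48 L31–L35 (held `paper:doi-10-1023-a-1000776613765` p0004): «Let `(G_i, t_i)_{i∈I}` be a family of pairs consisting of an
algebraic group `G_i` and a homomorphism `t_i : G_i → 𝔾_m`. We define the product `∏_{i∈I}(G_i, t_i)` of the family to be the pair `(G, t)`
consisting of the largest subgroup of `∏ G_i` on which the characters `(g_i)_{i∈I} ↦ t_{i₀}(g_{i₀})` agree and of the common restriction of these
characters to `G`.»  THEOREM 2.6 (p. 56): «the fundamental group `(T^K, t^K)` of `LCM^K(ℂ)` is `∏_Ψ (T^Ψ, t^Ψ)`, where the product is over the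
set of `Γ`-orbits of CM-types on `K`.»  §4 p. 62 L15–L16: «… whose fundamental group is `∏_{Π∈Γ\W^K_{1,+}(p^∞)} (L^Π, l^Π)`.»  THEOREM 6.1
(p. 66 L3–L4, L13–L17): «The homomorphism `(α, β) : P → S × L` … identifies `P` with `L ∩ S` (intersection in `T`)»; «`P^K = S^K ∩ L^K` (inside
`T^K`), or, equivalently, `P^K −(β^K, −α^K)→ L^K × S^K −(α′^K γ^K)→ T^K` is exact, for all sufficiently large `K`.»  §6 p. 68 L106–L118: «It
suffices to prove that [`X^*(T^K) → X^*(S^K)` over `X^*(L^K) → X^*(P^K)`] is almost Cartesian for all sufficiently large CM-fields `K` … We shall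
in fact prove it under the assumption that `K` – is finite and Galois over `ℚ`, – contains a quadratic imaginary extension `Q` of `ℚ` in which
`(p)` splits, – and is not equal to `Q`.»  p. 71 L22 – p. 72 L4: the diagram `⊕ X^*(T^Φ) → X^*(T^K) → X^*(S^K)` over `⊕ X^*(L^Π) → X^*(L^K) →
X^*(P^K)`, «Therefore the right hand square is almost Cartesian, which completes the proof of Theorem 6.1.»

WHAT THE TREE HAD.  The model (g17-#2…#5, namespace `CosetGerm`, any `h : Setting ι Γ₀ D`): `TK`/`LK` (products of pairs of the model's orbit
character modules), `tKToS`, `lKToP`, `alphaK`, **`exact_pairProduct`** (THEOREM 6.1 at level `K` in the model).  For the CM field `K` itself: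
g18-#2 `serreLatticeEquiv : X^*(S^K)(K) ≅ serreLattice`, `weilLatticeEquiv : X^*(P^K)(K) ≅ weilLattice` with `X^*(α^K)(K) = alphaCharIn ↦ alphaP`;
g18-#3 `exact_pairProduct_gal` (THEOREM 6.1 at level `K` with `K`'s own `S`- and `P`-vertices but the MODEL's `T`- and `L`-vertices); g18-#6 the
per-orbit identifications `cmOrbitCharEquivModel`, `weilOrbitCharEquivModel`, `toGroupRing_gammaCharK`, `germToCosetFun_betaCharIn_eq_orbitToP`,
`weilOrbitCharEquivModel_redChar`.

WHAT IS HERE (all PROVED).  §0 generic: **`AlmostCartesian.IsAlmostCartesian.of_equiv`** (almost cartesian squares transport along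
isomorphisms of squares); `PairProduct.piCongrRight_single`, `map_rel_piCongrRight`, DEF **`PairProduct.congrOf`** (products of pairs
along componentwise isomorphisms of pairs; `congrOf_mk`, `congrOf_mk_single`); `OrbitTorus.orbitClassCongr`/**`charModuleCongr`** (transport of
`CharModule R (c.orbit) ι` along `c₁ = c₂`; `_mk_single`, `_tChar`, `_rfl`, `_charModuleCongr`), `OrbitTorus.orbitCongr`/**`charModuleOrbitCongr`**
(along `G·a = G·b`; `_mk_single`, `_tChar`); `CosetGerm.orbitToS_charModuleCongr`, `orbitToP_charModuleCongr`, `pushOrbit_charModuleCongr`.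
§1 representatives: DEF `repType c = Φ_c` (g17-#5's base point of `c ∈ I` read as a CM type of `K`; `isCMTypeWith_repType`, `toCMTypes_repType`,
`cmOrbitClass_repType`), `exists_repTypeL`, DEF `repTypeL c′ = Φ_{c′}`, `repGerm c′ = ϖ_{c′} = π(Φ_{c′})` (`red_toCMTypes_repTypeL`,
`weilOrbitClass_repTypeL`).  §2: DEF **`tComp c : X^*(T^{Ψ_c})(K) ≃ₗ[ℤ] X^*(T^c)`** (`tComp_mk_single`, `coe_tCompPt`, **`tComp_tCM : t ↦ t^c`**),
DEF **`lComp c′ : X^*(L^{Π_{c′}})(K) ≃ₗ[ℤ] X^*(L^{c′})`** (`lComp_mk_single`, `coe_coe_lCompPt`, **`lComp_lWeil : l ↦ l^{c′}`**).  §3: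
`cmTypeGerm_repType_mem_orbit`, `orbit_cmTypeGerm_repType` (`π(Φ_c)` and `ϖ_{π(c)}` span the same orbit), DEF `germCast` (`_mk_single`, `_lWeil`),
`weilOrbitClass_repType_eq`, `weilOrbitCharEquivModel_germCast`, **`lComp_germCast_redChar`**.  §4 (THEOREM 2.6 / §4 p. 62 read on characters, for
`K`): DEF `tFamK`, **`TKK = X^*(T^K)(K)`**, `lFamK`, **`LKK = X^*(L^K)(K)`**, DEF **`tKEquiv : X^*(T^K)(K) ≃ₗ[ℤ] TK`**, **`lKEquiv : X^*(L^K)(K) ≃ₗ[ℤ]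
LK`** (`_mk`, `_mk_single`), DEF `tSumKToS` (`_single`, `_single_tFamK`), **`tKKToS : X^*(T^K)(K) → X^*(S^K)(K)`** (`_mk`), `repGerm_mem`, DEF
`lSumKToP` (`_single`, `_single_lFamK`), **`lKKToP : X^*(L^K)(K) → X^*(P^K)(K)`** (`_mk`), DEF `alphaSumK` (`_single`, `_single_tFamK`), **`alphaKK =
X^*(α′)(K)`** (`_mk`).  §5: `toGroupRing_tSumKToS`, **`serreLatticeEquiv_tKKToS`**, `germToCosetFun_lSumKToP`, **`weilLatticeEquiv_lKKToP`**,
`lComp_alphaSumK`, **`lKEquiv_alphaKK`**, `pairProductK_square_comm`.  §6: `serreLatticeEquiv_tSumKToS`, `weilLatticeEquiv_lSumKToP`,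
`piCongrRight_alphaSumK`, **`isAlmostCartesian_sumK`** (LEMMA 6.10 for `K`'s own summands), **`isAlmostCartesian_pairProductK`** («the right hand
square is almost Cartesian», for `K`'s own four vertices), **`exact_pairProductK`** — THEOREM 6.1 at level `K` on characters with `K`'s own four
vertices, for every `h : Setting ι Γ₀ D(w₀)` — and **`exact_pairProductK_of_split`** (the fields of p. 68: g18-#1 `cosetGermSetting`).
§7: DEF `tKK = t^K`, `lKK = l^K` (`mk_single_tFamK`, `mk_single_lFamK`), `tKEquiv_tKK`, `lKEquiv_lKK`, `tKKToS_tKK : t^K ↦ s`, `lKKToP_lKK : l^K ↦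
p^K`, `alphaKK_tKK : t^K ↦ l^K` (maps of pairs).

SCOPE / NOT HERE.  (1) `X^*(T^K)(K)`, `X^*(L^K)(K)` are the character modules of the products of pairs, indexed by the model's `I = CMOrbits h`,
`I′ = WeilOrbits ℤ h` (in bijection with the orbit sets of `K`, g18-#3/#6) at chosen representatives `Φ_c`, `ϖ_{c′}` (any other choice gives
isomorphic pairs: `OrbitTorus.congr`, `charModuleOrbitCongr`); the identification of `T^K` with the fundamental group of `LCM^K(ℂ)` (THEOREM 2.6 as a
statement about motives) and of `L^K` with that of the category of §4 are NOT here.  (2) The passage from character modules back to the groups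
`P^K, L^K, S^K, T^K` («identifies `P` with `L ∩ S`») and the limit over `K` (THEOREM 6.1 as printed) are Layer B (B5-09).  (3) Nothing here is
a case of the Hodge conjecture.

## References
* [Milne1999] J. S. Milne, *Lefschetz motives and the Tate conjecture*, Compositio Math. 117 (1999) 45–76 — §1 p. 48 L31–L35, Thm 2.6 p. 56,
  §4 p. 62 L15–L16, §6 p. 66 L3–L4 / L13–L17 (Theorem 6.1), p. 68 L106–L118, p. 71 L22 – p. 72 L4 (held `paper:doi-10-1023-a-1000776613765`
  p0004, p0012, p0018, p0022, p0024, p0027, p0028).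

## Provenance
lit-hodgefound seat p27, generation 18, row g18-#7 (Milne 1999 THEOREM 6.1 at level `K` on characters with the CM field `K`'s own four vertices).
-/

set_option autoImplicit false

noncomputable section

open scoped NumberField Pointwise

namespace Literature.NumberTheory.ComplexMultiplication

/-! ### §0 Generic: products of pairs along componentwise isomorphisms; transport of orbit character modules along an equality of classes -/

namespace AlmostCartesian

variable {R : Type*} [CommRing R]
variable {N' N M' M N₁' N₁ M₁' M₁ : Type*} [AddCommGroup N'] [AddCommGroup N] [AddCommGroup M'] [AddCommGroup M]
  [AddCommGroup N₁'] [AddCommGroup N₁] [AddCommGroup M₁'] [AddCommGroup M₁]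
  [Module R N'] [Module R N] [Module R M'] [Module R M] [Module R N₁'] [Module R N₁] [Module R M₁'] [Module R M₁]
variable {α' : N' →ₗ[R] M'} {γ : N' →ₗ[R] N} {β : M' →ₗ[R] M} {α : N →ₗ[R] M}

/-- **Almost cartesian squares are transported along isomorphisms of squares**: if `(α′, γ, β, α)` is almost cartesian and the square
`(α₁′, γ₁, β₁, α₁)` maps isomorphically onto it vertex by vertex, compatibly with the four arrows, then it is almost cartesian.
[cite: Milne1999, §6 p. 66 («Almost cartesian squares»)] -/
theorem IsAlmostCartesian.of_equiv (h : IsAlmostCartesian α' γ β α) (eN' : N₁' ≃ₗ[R] N') (eN : N₁ ≃ₗ[R] N) (eM' : M₁' ≃ₗ[R] M')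
    (eM : M₁ ≃ₗ[R] M) (α₁' : N₁' →ₗ[R] M₁') (γ₁ : N₁' →ₗ[R] N₁) (β₁ : M₁' →ₗ[R] M₁) (α₁ : N₁ →ₗ[R] M₁)
    (hα' : ∀ x, eM' (α₁' x) = α' (eN' x)) (hγ : ∀ x, eN (γ₁ x) = γ (eN' x)) (hβ : ∀ y, eM (β₁ y) = β (eM' y))
    (hα : ∀ n, eM (α₁ n) = α (eN n)) : IsAlmostCartesian α₁' γ₁ β₁ α₁ := by
  refine ⟨fun x => eM.injective ?_, fun y => ?_, fun n => ?_, fun m => ?_, fun m => ?_, fun y n e => ?_⟩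
  · rw [hβ, hα', hα, hγ]
    exact h.comm _
  · obtain ⟨x, hx⟩ := h.surjective_left (eM' y)
    obtain ⟨x₁, rfl⟩ := eN'.surjective x
    exact ⟨x₁, eM'.injective (by rw [hα', hx])⟩
  · obtain ⟨x, hx⟩ := h.surjective_top (eN n)
    obtain ⟨x₁, rfl⟩ := eN'.surjective x
    exact ⟨x₁, eN.injective (by rw [hγ, hx])⟩
  · obtain ⟨y, hy⟩ := h.surjective_bottom (eM m)
    obtain ⟨y₁, rfl⟩ := eM'.surjective y
    exact ⟨y₁, eM.injective (by rw [hβ, hy])⟩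
  · obtain ⟨n, hn⟩ := h.surjective_right (eM m)
    obtain ⟨n₁, rfl⟩ := eN.surjective n
    exact ⟨n₁, eM.injective (by rw [hα, hn])⟩
  · have e' : β (eM' y) = α (eN n) := by rw [← hβ, ← hα, e]
    obtain ⟨x, h1, h2⟩ := h.lift _ _ e'
    obtain ⟨x₁, rfl⟩ := eN'.surjective x
    exact ⟨x₁, eM'.injective (by rw [hα', h1]), eN.injective (by rw [hγ, h2])⟩

end AlmostCartesian

namespace PairProduct

variable (R : Type*) [CommRing R] {I : Type*} {M M' : I → Type*} [∀ i, AddCommGroup (M i)] [∀ i, Module R (M i)]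
  [∀ i, AddCommGroup (M' i)] [∀ i, Module R (M' i)] [DecidableEq I] (t : ∀ i, M i) (t' : ∀ i, M' i)
  (e : ∀ i, M i ≃ₗ[R] M' i) (he : ∀ i, e i (t i) = t' i)

/-- `⊕_i e_i` on `⊕_i M_i` sends `δ_i x` to `δ_i (e_i x)`. [cite: Milne1999, §1 p. 48 L31–L35] -/
theorem piCongrRight_single (i : I) (x : M i) :
    LinearEquiv.piCongrRight e (Pi.single i x) = Pi.single i (e i x) := by
  ext j
  rw [LinearEquiv.piCongrRight_apply]
  exact Pi.apply_single (fun k (y : M k) => e k y) (fun k => map_zero (e k)) i x j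

include he in
/-- `⊕_i e_i` carries the relations `δ_i t_i − δ_j t_j` onto the relations `δ_i t′_i − δ_j t′_j`. [cite: Milne1999, §1 p. 48 L31–L35] -/
theorem map_rel_piCongrRight : (rel R t).map (LinearEquiv.piCongrRight e).toLinearMap = rel R t' := by
  rw [rel, rel, Submodule.map_span]
  congr 1
  ext x
  constructor
  · rintro ⟨y, ⟨i, j, rfl⟩, rfl⟩
    exact ⟨i, j, by rw [LinearEquiv.coe_coe, map_sub, piCongrRight_single, piCongrRight_single, he, he]⟩
  · rintro ⟨i, j, rfl⟩
    exact ⟨Pi.single i (t i) - Pi.single j (t j), ⟨i, j, rfl⟩, by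
      rw [LinearEquiv.coe_coe, map_sub, piCongrRight_single, piCongrRight_single, he, he]⟩

/-- **Products of pairs along isomorphisms of pairs**: componentwise isomorphisms `e_i : (M_i, t_i) ≅ (M′_i, t′_i)` induce
`X^*(∏ (G_i, t_i)) ≅ X^*(∏ (G′_i, t′_i))` on the amalgamated sums. [cite: Milne1999, §1 p. 48 L31–L35] -/
def congrOf : Amalg R t ≃ₗ[R] Amalg R t' :=
  Submodule.Quotient.equiv (rel R t) (rel R t') (LinearEquiv.piCongrRight e) (map_rel_piCongrRight R t t' e he)

/-- [cite: Milne1999, §1 p. 48 L31–L35] -/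
@[simp] theorem congrOf_mk (x : ∀ i, M i) :
    congrOf R t t' e he (Submodule.Quotient.mk x) = Submodule.Quotient.mk (fun i => e i (x i)) := rfl

/-- [cite: Milne1999, §1 p. 48 L31–L35] -/
theorem congrOf_mk_single (i : I) (x : M i) :
    congrOf R t t' e he (Submodule.Quotient.mk (Pi.single i x)) = Submodule.Quotient.mk (Pi.single i (e i x)) := by
  rw [congrOf_mk]
  exact congrArg Submodule.Quotient.mk (piCongrRight_single R e i x)

end PairProduct

namespace OrbitTorus

section ClassCongr

variable {G α : Type*} [Group G] [MulAction G α]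

/-- The identity bijection `c₁.orbit ≃ c₂.orbit` along an equality `c₁ = c₂` of orbit classes. [folklore] -/
def orbitClassCongr {c₁ c₂ : MulAction.orbitRel.Quotient G α} (e : c₁ = c₂) :
    MulAction.orbitRel.Quotient.orbit c₁ ≃ MulAction.orbitRel.Quotient.orbit c₂ :=
  Equiv.setCongr (congrArg MulAction.orbitRel.Quotient.orbit e)

/-- [cite: Milne1999, §2 p. 56 L19–L22] -/
@[simp] theorem coe_orbitClassCongr {c₁ c₂ : MulAction.orbitRel.Quotient G α} (e : c₁ = c₂) (x : MulAction.orbitRel.Quotient.orbit c₁) :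
    ((orbitClassCongr e x : MulAction.orbitRel.Quotient.orbit c₂) : α) = x := rfl

/-- [cite: Milne1999, §2 p. 56 L19–L22] -/
theorem orbitClassCongr_smul {c₁ c₂ : MulAction.orbitRel.Quotient G α} (e : c₁ = c₂) (g : G) (x : MulAction.orbitRel.Quotient.orbit c₁) :
    orbitClassCongr e (g • x) = g • orbitClassCongr e x :=
  Subtype.ext rfl

variable (R : Type*) [CommRing R] (ι : G)

/-- **Transport of `CharModule R (c.orbit) ι` along an equality of orbit classes** (Q731 `OrbitTorus.congr` along the identity bijection).
[cite: Milne1999, §2 p. 56 L19–L22] -/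
def charModuleCongr {c₁ c₂ : MulAction.orbitRel.Quotient G α} (e : c₁ = c₂) :
    CharModule R (MulAction.orbitRel.Quotient.orbit c₁) ι ≃ₗ[R] CharModule R (MulAction.orbitRel.Quotient.orbit c₂) ι :=
  congr R ι (orbitClassCongr e) (orbitClassCongr_smul e)

/-- [cite: Milne1999, §2 p. 56 L19–L22] -/
theorem charModuleCongr_mk_single {c₁ c₂ : MulAction.orbitRel.Quotient G α} (e : c₁ = c₂) (x : MulAction.orbitRel.Quotient.orbit c₁) (r : R) :
    charModuleCongr R ι e (Submodule.Quotient.mk (Finsupp.single x r)) = Submodule.Quotient.mk (Finsupp.single (orbitClassCongr e x) r) := by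
  rw [charModuleCongr, congr_mk, transfer_single]

/-- [cite: Milne1999, §2 p. 56 L19–L22] -/
theorem charModuleCongr_tChar {c₁ c₂ : MulAction.orbitRel.Quotient G α} (e : c₁ = c₂) (x : MulAction.orbitRel.Quotient.orbit c₁) :
    charModuleCongr R ι e (tChar R ι x) = tChar R ι (orbitClassCongr e x) :=
  congr_tChar R ι _ _ x

/-- Along `rfl` the transport is the identity. [cite: Milne1999, §2 p. 56 L19–L22] -/
theorem charModuleCongr_rfl {c : MulAction.orbitRel.Quotient G α} (z : CharModule R (MulAction.orbitRel.Quotient.orbit c) ι) :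
    charModuleCongr R ι (rfl : c = c) z = z := by
  induction z using Submodule.Quotient.induction_on with | H f => ?_
  induction f using Finsupp.induction_linear with
  | zero => simp only [Submodule.Quotient.mk_zero, map_zero]
  | add f₁ f₂ h₁ h₂ => simp only [Submodule.Quotient.mk_add, map_add, h₁, h₂]
  | single x r => rw [charModuleCongr_mk_single]; rfl

/-- Transports compose (proof-irrelevantly). [cite: Milne1999, §2 p. 56 L19–L22] -/
theorem charModuleCongr_charModuleCongr {c₁ c₂ c₃ : MulAction.orbitRel.Quotient G α} (e : c₁ = c₂) (e' : c₂ = c₃)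
    (z : CharModule R (MulAction.orbitRel.Quotient.orbit c₁) ι) :
    charModuleCongr R ι e' (charModuleCongr R ι e z) = charModuleCongr R ι (e.trans e') z := by
  subst e; subst e'
  rw [charModuleCongr_rfl, charModuleCongr_rfl]

/-- The identity bijection `G·a ≃ G·b` along an equality of orbits. [folklore] -/
def orbitCongr {a b : α} (e : MulAction.orbit G a = MulAction.orbit G b) : MulAction.orbit G a ≃ MulAction.orbit G b := Equiv.setCongr e

/-- [cite: Milne1999, §4 p. 60 L25–L26] -/
@[simp] theorem coe_orbitCongr {a b : α} (e : MulAction.orbit G a = MulAction.orbit G b) (x : MulAction.orbit G a) :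
    ((orbitCongr e x : MulAction.orbit G b) : α) = x := rfl

/-- [cite: Milne1999, §4 p. 60 L25–L26] -/
theorem orbitCongr_smul {a b : α} (e : MulAction.orbit G a = MulAction.orbit G b) (g : G) (x : MulAction.orbit G a) :
    orbitCongr e (g • x) = g • orbitCongr e x :=
  Subtype.ext rfl

/-- **Transport of `CharModule R (G·a) ι` along an equality of orbits `G·a = G·b`** («independent of the choice of `π ∈ Π`»).
[cite: Milne1999, §4 p. 60 L25–L26] -/
def charModuleOrbitCongr {a b : α} (e : MulAction.orbit G a = MulAction.orbit G b) :
    CharModule R (MulAction.orbit G a) ι ≃ₗ[R] CharModule R (MulAction.orbit G b) ι :=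
  congr R ι (orbitCongr e) (orbitCongr_smul e)

/-- [cite: Milne1999, §4 p. 60 L25–L26] -/
theorem charModuleOrbitCongr_mk_single {a b : α} (e : MulAction.orbit G a = MulAction.orbit G b) (x : MulAction.orbit G a) (r : R) :
    charModuleOrbitCongr R ι e (Submodule.Quotient.mk (Finsupp.single x r)) = Submodule.Quotient.mk (Finsupp.single (orbitCongr e x) r) := by
  rw [charModuleOrbitCongr, congr_mk, transfer_single]

/-- [cite: Milne1999, §4 p. 60 L25–L26] -/
theorem charModuleOrbitCongr_tChar {a b : α} (e : MulAction.orbit G a = MulAction.orbit G b) (x : MulAction.orbit G a) :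
    charModuleOrbitCongr R ι e (tChar R ι x) = tChar R ι (orbitCongr e x) :=
  congr_tChar R ι _ _ x

end ClassCongr

end OrbitTorus

namespace CosetGerm

section ClassCongr

variable {Γ : Type*} [Group Γ] {ι : Γ} {Γ₀ D : Subgroup Γ} [Fintype Γ] [DecidableEq Γ] (R : Type*) [CommRing R] (h : Setting ι Γ₀ D)

open OrbitTorus (charModuleCongr charModuleCongr_rfl)

/-- `X^*(T^c) → X^*(S^K)` is insensitive to re-indexing along `c₁ = c₂`. [cite: Milne1999, §6 p. 71 L16] -/
theorem orbitToS_charModuleCongr [NoZeroDivisors R] (h2 : (2 : R) ≠ 0) {c₁ c₂ : CMOrbits h} (e : c₁ = c₂)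
    (z : OrbitTorus.CharModule R (MulAction.orbitRel.Quotient.orbit c₁) ι) : orbitToS R h h2 c₂ (charModuleCongr R ι e z) = orbitToS R h h2 c₁ z := by
  subst e
  rw [charModuleCongr_rfl]

/-- `X^*(L^{c′}) → X^*(P^K)` is insensitive to re-indexing along `c′₁ = c′₂`. [cite: Milne1999, §6 p. 71 L17] -/
theorem orbitToP_charModuleCongr [NoZeroDivisors R] (h2 : (2 : R) ≠ 0) {c₁ c₂ : WeilOrbits R h} (e : c₁ = c₂)
    (z : OrbitTorus.CharModule R (MulAction.orbitRel.Quotient.orbit c₁) ι) : orbitToP R h h2 c₂ (charModuleCongr R ι e z) = orbitToP R h h2 c₁ z := by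
  subst e
  rw [charModuleCongr_rfl]

omit [Fintype Γ] in
/-- The summand of `α″` is insensitive to re-indexing along `c₁ = c₂`. [cite: Milne1999, §6 p. 71 L16–L17] -/
theorem pushOrbit_charModuleCongr {c₁ c₂ : CMOrbits h} (e : c₁ = c₂) (z : OrbitTorus.CharModule R (MulAction.orbitRel.Quotient.orbit c₁) ι) :
    pushOrbit R h c₂ (charModuleCongr R ι e z) = charModuleCongr R ι (congrArg (redI R h) e) (pushOrbit R h c₁ z) := by
  subst e
  rw [charModuleCongr_rfl]
  exact (charModuleCongr_rfl R ι _).symm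

end ClassCongr

end CosetGerm

/-! ### §1 Representatives: a CM type `Φ_c` of `K` for each `c ∈ I`, a CM type `Φ_{c′}` (and its germ) for each `c′ ∈ I′` -/

namespace CMNumbers

open _root_.NumberField IntermediateField Finset
open Literature.NumberTheory.NumberFields (cmNumbers cmNumbersConj cmNumbersConj_mul_comm)
open OrbitTorus (pushFun act charModuleCongr orbitClassCongr charModuleOrbitCongr orbitCongr)
open CosetGerm (Setting CMTypes CMOrbits WeilGerms WeilOrbits red ind)
open SerreGroupTorus (infinityTypesRep constChar)
open AlmostCartesian (IsAlmostCartesian)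

section Reps

variable {K : Type} [Field K] [NumberField K] [IsCMField K] [IsGalois ℚ K]
variable (p : ℕ) [hp : Fact p.Prime] (𝔭 : Ideal (𝓞 K)) [h𝔭P : 𝔭.IsPrime] [h𝔭 : 𝔭.LiesOver (Ideal.span {(p : ℤ)})]
variable (τ₀ : K →ₐ[ℚ] cmNumbers)
variable {Γ₀ : Subgroup (K ≃ₐ[ℚ] K)} (h : Setting (conjGal : K ≃ₐ[ℚ] K) Γ₀ (decompositionGroup p 𝔭)) [DecidableEq (K ≃ₐ[ℚ] K)]

/-- **`Φ_c`, a CM type of `K` representing `c ∈ I`**: g17-#5's base point `c.out` read as a CM type of `K` (g18-#3 `ofCMTypes`).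
[cite: Milne1999, Thm 2.6 p. 56 («the product is over the set of `Γ`-orbits of CM-types on `K`»)] -/
def repType (c : CMOrbits h) : Set (K →ₐ[ℚ] cmNumbers) := ofCMTypes τ₀ h (CosetGerm.basePt h c).1

omit hp in
/-- [cite: Milne1999, Thm 2.6 p. 56] -/
theorem isCMTypeWith_repType (c : CMOrbits h) : IsCMTypeWith (cmNumbersConj : cmNumbers ≃ₐ[ℚ] cmNumbers) (repType p 𝔭 τ₀ h c) :=
  isCMTypeWith_ofCMTypes τ₀ h _

omit hp in
/-- `Φ_c` read on `Γ` is the base point of `c`. [cite: Milne1999, Thm 2.6 p. 56] -/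
theorem toCMTypes_repType (c : CMOrbits h) : toCMTypes τ₀ h (isCMTypeWith_repType p 𝔭 τ₀ h c) = (CosetGerm.basePt h c).1 :=
  toCMTypes_ofCMTypes τ₀ h _

omit hp in
/-- The class of `Φ_c` is `c`. [cite: Milne1999, Thm 2.6 p. 56] -/
theorem cmOrbitClass_repType (c : CMOrbits h) : cmOrbitClass τ₀ h (isCMTypeWith_repType p 𝔭 τ₀ h c) = c := by
  show Quotient.mk'' (toCMTypes τ₀ h _) = c
  rw [toCMTypes_repType]
  exact MulAction.orbitRel.Quotient.mem_orbit.1 (CosetGerm.basePt h c).2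

/-- For `c′ ∈ I′` there is a CM type `Φ` of `K` with `red(Φ on Γ)` the base point of `c′` (g18-#3 `exists_cmTypeChar_of_weilGerms`: every Weil germ
of the model is an `f_{π(Φ)}`). [cite: Milne1999, §4 p. 62 L15–L16, §5 pp. 64–65] -/
theorem exists_repTypeL (c' : WeilOrbits ℤ h) :
    ∃ (Φ : Set (K →ₐ[ℚ] cmNumbers)) (hΦ : IsCMTypeWith (cmNumbersConj : cmNumbers ≃ₐ[ℚ] cmNumbers) Φ),
      red ℤ h (toCMTypes τ₀ h hΦ) = (CosetGerm.basePt' ℤ h c').1 := by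
  obtain ⟨Φ, hΦ, e⟩ := exists_cmTypeChar_of_weilGerms p 𝔭 τ₀ h (CosetGerm.basePt' ℤ h c').1
  exact ⟨Φ, hΦ, CosetGerm.WeilGerms.ext ℤ h (by rw [coe_red_toCMTypes p 𝔭 τ₀ h hΦ]; exact e.symm)⟩

/-- **`Φ_{c′}`, a CM type of `K` whose germ `π(Φ_{c′})` represents `c′ ∈ I′`.** [cite: Milne1999, §4 p. 62 L15–L16] -/
def repTypeL (c' : WeilOrbits ℤ h) : Set (K →ₐ[ℚ] cmNumbers) := (exists_repTypeL p 𝔭 τ₀ h c').choose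

/-- [cite: Milne1999, §4 p. 62 L15–L16] -/
theorem isCMTypeWith_repTypeL (c' : WeilOrbits ℤ h) : IsCMTypeWith (cmNumbersConj : cmNumbers ≃ₐ[ℚ] cmNumbers) (repTypeL p 𝔭 τ₀ h c') :=
  (exists_repTypeL p 𝔭 τ₀ h c').choose_spec.choose

/-- `red(Φ_{c′} on Γ)` is the base point of `c′`. [cite: Milne1999, §4 p. 62 L15–L16] -/
theorem red_toCMTypes_repTypeL (c' : WeilOrbits ℤ h) :
    red ℤ h (toCMTypes τ₀ h (isCMTypeWith_repTypeL p 𝔭 τ₀ h c')) = (CosetGerm.basePt' ℤ h c').1 :=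
  (exists_repTypeL p 𝔭 τ₀ h c').choose_spec.choose_spec

/-- **`ϖ_{c′} = π(Φ_{c′}) ∈ W^K_{1,+}(p^∞)`, a germ of `K` representing `c′ ∈ I′`.** [cite: Milne1999, §4 p. 62 L15–L16] -/
abbrev repGerm (c' : WeilOrbits ℤ h) : WeilLimit p := cmTypeGerm p 𝔭 (isCMTypeWith_repTypeL p 𝔭 τ₀ h c')

/-- The class of `ϖ_{c′}` is `c′`. [cite: Milne1999, §4 p. 62 L15–L16] -/
theorem weilOrbitClass_repTypeL (c' : WeilOrbits ℤ h) : weilOrbitClass p 𝔭 τ₀ h (isCMTypeWith_repTypeL p 𝔭 τ₀ h c') = c' := by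
  rw [weilOrbitClass_eq, red_toCMTypes_repTypeL]
  exact MulAction.orbitRel.Quotient.mem_orbit.1 (CosetGerm.basePt' ℤ h c').2

/-! ### §2 `X^*(T^{Ψ_c})(K) ≅ X^*(T^c)` with `t ↦ t^c`, `X^*(L^{Π_{c′}})(K) ≅ X^*(L^{c′})` with `l ↦ l^{c′}` -/

/-- **`X^*(T^{Ψ_c})(K) ≅ X^*(T^c)`**: g18-#6 `cmOrbitCharEquivModel` for `Φ_c`, landed in the summand of `c` itself. [cite: Milne1999, Thm 2.6 p. 56;
§6 p. 71 L15–L16] -/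
def tComp (c : CMOrbits h) :
    cmOrbitChar ℤ (repType p 𝔭 τ₀ h c) ≃ₗ[ℤ] OrbitTorus.CharModule ℤ (MulAction.orbitRel.Quotient.orbit c) (conjGal : K ≃ₐ[ℚ] K) :=
  (cmOrbitCharEquivModel τ₀ h (isCMTypeWith_repType p 𝔭 τ₀ h c)).trans
    (charModuleCongr ℤ (conjGal : K ≃ₐ[ℚ] K) (cmOrbitClass_repType p 𝔭 τ₀ h c))

omit hp in
/-- `[δ_Φ] ↦ [δ_{Φ on Γ}]`. [cite: Milne1999, §6 p. 71 L15–L16] -/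
theorem tComp_mk_single (c : CMOrbits h) (Φ : MulAction.orbit (cmNumbers ≃ₐ[ℚ] cmNumbers) (repType p 𝔭 τ₀ h c)) (r : ℤ) :
    tComp p 𝔭 τ₀ h c (Submodule.Quotient.mk (Finsupp.single Φ r)) =
      Submodule.Quotient.mk (Finsupp.single
        (orbitClassCongr (cmOrbitClass_repType p 𝔭 τ₀ h c) (cmOrbitMap τ₀ h (isCMTypeWith_repType p 𝔭 τ₀ h c) Φ)) r) :=
  (congrArg (charModuleCongr ℤ (conjGal : K ≃ₐ[ℚ] K) (cmOrbitClass_repType p 𝔭 τ₀ h c))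
    (cmOrbitCharEquivModel_mk_single τ₀ h _ Φ r)).trans (OrbitTorus.charModuleCongr_mk_single ℤ _ _ _ r)

omit hp in
/-- The underlying CM type on `Γ` of the image of `[δ_Φ]`: `Φ on Γ`. [cite: Milne1999, §6 p. 71 L15–L16] -/
theorem coe_tCompPt (c : CMOrbits h) (Φ : MulAction.orbit (cmNumbers ≃ₐ[ℚ] cmNumbers) (repType p 𝔭 τ₀ h c)) :
    ((orbitClassCongr (cmOrbitClass_repType p 𝔭 τ₀ h c) (cmOrbitMap τ₀ h (isCMTypeWith_repType p 𝔭 τ₀ h c) Φ) :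
      MulAction.orbitRel.Quotient.orbit c) : CMTypes h) = toCMTypes τ₀ h (isCMTypeWith_of_mem_orbit (isCMTypeWith_repType p 𝔭 τ₀ h c) Φ) := rfl

omit hp in
/-- **`t ↦ t^c`.** [cite: Milne1999, Thm 2.6 p. 56; §2 p. 55 L45–L48] -/
theorem tComp_tCM (c : CMOrbits h) : tComp p 𝔭 τ₀ h c (tCM ℤ (repType p 𝔭 τ₀ h c)) = CosetGerm.tFam ℤ h c :=
  ((congrArg (charModuleCongr ℤ (conjGal : K ≃ₐ[ℚ] K) (cmOrbitClass_repType p 𝔭 τ₀ h c)) (cmOrbitCharEquivModel_tCM τ₀ h _)).trans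
    (OrbitTorus.charModuleCongr_tChar ℤ _ _ _)).trans (CosetGerm.tChar_eq_tFam ℤ h c _)

/-- **`X^*(L^{Π_{c′}})(K) ≅ X^*(L^{c′})`**: g18-#6 `weilOrbitCharEquivModel` for `Φ_{c′}`, landed in the summand of `c′` itself. [cite: Milne1999, §4 p. 62
L15–L16; §6 p. 71 L17] -/
def lComp (c' : WeilOrbits ℤ h) :
    weilOrbitChar ℤ (repGerm p 𝔭 τ₀ h c') ≃ₗ[ℤ] OrbitTorus.CharModule ℤ (MulAction.orbitRel.Quotient.orbit c') (conjGal : K ≃ₐ[ℚ] K) :=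
  (weilOrbitCharEquivModel p 𝔭 τ₀ h (isCMTypeWith_repTypeL p 𝔭 τ₀ h c')).trans
    (charModuleCongr ℤ (conjGal : K ≃ₐ[ℚ] K) (weilOrbitClass_repTypeL p 𝔭 τ₀ h c'))

/-- `[δ_π] ↦ [δ_{f_π}]`. [cite: Milne1999, §6 p. 71 L17] -/
theorem lComp_mk_single (c' : WeilOrbits ℤ h) (π : MulAction.orbit (cmNumbers ≃ₐ[ℚ] cmNumbers) (repGerm p 𝔭 τ₀ h c')) (r : ℤ) :
    lComp p 𝔭 τ₀ h c' (Submodule.Quotient.mk (Finsupp.single π r)) =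
      Submodule.Quotient.mk (Finsupp.single
        (orbitClassCongr (weilOrbitClass_repTypeL p 𝔭 τ₀ h c') (weilOrbitMap p 𝔭 τ₀ h (isCMTypeWith_repTypeL p 𝔭 τ₀ h c') π)) r) :=
  (congrArg (charModuleCongr ℤ (conjGal : K ≃ₐ[ℚ] K) (weilOrbitClass_repTypeL p 𝔭 τ₀ h c'))
    (weilOrbitCharEquivModel_mk_single p 𝔭 τ₀ h _ π r)).trans (OrbitTorus.charModuleCongr_mk_single ℤ _ _ _ r)

/-- The underlying Weil germ of the image of `[δ_π]`: `f_π`. [cite: Milne1999, §6 p. 71 L17] -/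
theorem coe_coe_lCompPt (c' : WeilOrbits ℤ h) (π : MulAction.orbit (cmNumbers ≃ₐ[ℚ] cmNumbers) (repGerm p 𝔭 τ₀ h c')) :
    (((orbitClassCongr (weilOrbitClass_repTypeL p 𝔭 τ₀ h c') (weilOrbitMap p 𝔭 τ₀ h (isCMTypeWith_repTypeL p 𝔭 τ₀ h c') π)) :
      MulAction.orbitRel.Quotient.orbit c') : WeilGerms ℤ h).1 =
      germToCosetFun p 𝔭 τ₀ (Additive.ofMul ⟨(π : WeilLimit p),
        coe_orbit_mem_weilLimitIn p τ₀ (cmTypeGerm_mem_weilLimitInOnePlus p 𝔭 τ₀ (isCMTypeWith_repTypeL p 𝔭 τ₀ h c')).1 π⟩) := rfl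

/-- **`l ↦ l^{c′}`.** [cite: Milne1999, §4 p. 62 L15–L16; §2 p. 55 L45–L48] -/
theorem lComp_lWeil (c' : WeilOrbits ℤ h) : lComp p 𝔭 τ₀ h c' (lWeil ℤ (repGerm p 𝔭 τ₀ h c')) = CosetGerm.lFam ℤ h c' :=
  ((congrArg (charModuleCongr ℤ (conjGal : K ≃ₐ[ℚ] K) (weilOrbitClass_repTypeL p 𝔭 τ₀ h c')) (weilOrbitCharEquivModel_lWeil p 𝔭 τ₀ h _)).trans
    (OrbitTorus.charModuleCongr_tChar ℤ _ _ _)).trans (CosetGerm.tChar_eq_lFam ℤ h c' _)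

end Reps

/-! ### §3 The germ orbit of `Φ_c` is the germ orbit of `ϖ_{π(c)}`: `X^*(L^{Π(Ψ_c)})(K) = X^*(L^{Π_{π(c)}})(K)` -/

section GermCast

variable {K : Type} [Field K] [NumberField K] [IsCMField K] [IsGalois ℚ K]
variable (p : ℕ) [hp : Fact p.Prime] (𝔭 : Ideal (𝓞 K)) [h𝔭P : 𝔭.IsPrime] [h𝔭 : 𝔭.LiesOver (Ideal.span {(p : ℤ)})]
variable (τ₀ : K →ₐ[ℚ] cmNumbers)
variable {Γ₀ : Subgroup (K ≃ₐ[ℚ] K)} (h : Setting (conjGal : K ≃ₐ[ℚ] K) Γ₀ (decompositionGroup p 𝔭)) [DecidableEq (K ≃ₐ[ℚ] K)]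

/-- `π(Φ_c)` lies in the `Gal(ℚ^{cm}/ℚ)`-orbit of `ϖ_{π(c)}` (both germs map to the class `π(c) ∈ I′` under the injective `π ↦ f_π`).
[cite: Milne1999, §5 pp. 64–65; §6 p. 71 L15–L17] -/
theorem cmTypeGerm_repType_mem_orbit (c : CMOrbits h) :
    cmTypeGerm p 𝔭 (isCMTypeWith_repType p 𝔭 τ₀ h c) ∈
      MulAction.orbit (cmNumbers ≃ₐ[ℚ] cmNumbers) (repGerm p 𝔭 τ₀ h (CosetGerm.redI ℤ h c)) := by
  have hmem : red ℤ h (toCMTypes τ₀ h (isCMTypeWith_repType p 𝔭 τ₀ h c)) ∈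
      MulAction.orbitRel.Quotient.orbit (weilOrbitClass p 𝔭 τ₀ h (isCMTypeWith_repTypeL p 𝔭 τ₀ h (CosetGerm.redI ℤ h c))) := by
    rw [weilOrbitClass_repTypeL, toCMTypes_repType]
    exact (CosetGerm.redOrbit ℤ h c (CosetGerm.basePt h c)).2
  obtain ⟨π, hπ⟩ := weilOrbitMap_surjective p 𝔭 τ₀ h (isCMTypeWith_repTypeL p 𝔭 τ₀ h (CosetGerm.redI ℤ h c)) ⟨_, hmem⟩
  have e1 : ((weilOrbitMap p 𝔭 τ₀ h _ π : MulAction.orbitRel.Quotient.orbit _) : WeilGerms ℤ h).1 =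
      (red ℤ h (toCMTypes τ₀ h (isCMTypeWith_repType p 𝔭 τ₀ h c))).1 := by
    rw [hπ]
  rw [coe_coe_weilOrbitMap, ← germToCosetFun_ofMul_cmTypeGerm p 𝔭 τ₀ h (isCMTypeWith_repType p 𝔭 τ₀ h c)
    (cmTypeGerm_mem_weilLimitInOnePlus p 𝔭 τ₀ (isCMTypeWith_repType p 𝔭 τ₀ h c)).1] at e1
  have e2 := congrArg (fun z => ((Additive.toMul z : weilLimitIn K p τ₀) : WeilLimit p)) (germToCosetFun_injective p 𝔭 τ₀ e1)
  change (π : WeilLimit p) = cmTypeGerm p 𝔭 (isCMTypeWith_repType p 𝔭 τ₀ h c) at e2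
  rw [← e2]
  exact π.2

/-- The two germ orbits coincide. [cite: Milne1999, §5 pp. 64–65; §4 p. 60 L25–L26] -/
theorem orbit_cmTypeGerm_repType (c : CMOrbits h) :
    MulAction.orbit (cmNumbers ≃ₐ[ℚ] cmNumbers) (cmTypeGerm p 𝔭 (isCMTypeWith_repType p 𝔭 τ₀ h c)) =
      MulAction.orbit (cmNumbers ≃ₐ[ℚ] cmNumbers) (repGerm p 𝔭 τ₀ h (CosetGerm.redI ℤ h c)) :=
  MulAction.orbit_eq_iff.mpr (cmTypeGerm_repType_mem_orbit p 𝔭 τ₀ h c)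

/-- **`X^*(L^{Π(Ψ_c)})(K) = X^*(L^{Π_{π(c)}})(K)`** (the same orbit torus, seen from the two base points `π(Φ_c)` and `ϖ_{π(c)}`).
[cite: Milne1999, §4 p. 60 L25–L26 («independent of the choice of `π ∈ Π`»)] -/
def germCast (c : CMOrbits h) :
    weilOrbitChar ℤ (cmTypeGerm p 𝔭 (isCMTypeWith_repType p 𝔭 τ₀ h c)) ≃ₗ[ℤ] weilOrbitChar ℤ (repGerm p 𝔭 τ₀ h (CosetGerm.redI ℤ h c)) :=
  charModuleOrbitCongr ℤ (cmNumbersConj : cmNumbers ≃ₐ[ℚ] cmNumbers) (orbit_cmTypeGerm_repType p 𝔭 τ₀ h c)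

/-- [cite: Milne1999, §4 p. 60 L25–L26] -/
theorem germCast_mk_single (c : CMOrbits h)
    (π : MulAction.orbit (cmNumbers ≃ₐ[ℚ] cmNumbers) (cmTypeGerm p 𝔭 (isCMTypeWith_repType p 𝔭 τ₀ h c))) (r : ℤ) :
    germCast p 𝔭 τ₀ h c (Submodule.Quotient.mk (Finsupp.single π r)) =
      Submodule.Quotient.mk (Finsupp.single (orbitCongr (orbit_cmTypeGerm_repType p 𝔭 τ₀ h c) π) r) :=
  OrbitTorus.charModuleOrbitCongr_mk_single ℤ _ _ π r

/-- `l ↦ l`. [cite: Milne1999, §4 p. 60 L25–L26] -/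
theorem germCast_lWeil (c : CMOrbits h) :
    germCast p 𝔭 τ₀ h c (lWeil ℤ (cmTypeGerm p 𝔭 (isCMTypeWith_repType p 𝔭 τ₀ h c))) = lWeil ℤ (repGerm p 𝔭 τ₀ h (CosetGerm.redI ℤ h c)) :=
  (OrbitTorus.charModuleOrbitCongr_tChar ℤ _ _ _).trans (lWeil_eq_tChar ℤ _ _).symm

/-- The classes in `I′` of `π(Φ_c)` and of `ϖ_{π(c)}` agree (both are `π(c)`). [cite: Milne1999, §5 pp. 64–65] -/
theorem weilOrbitClass_repType_eq (c : CMOrbits h) :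
    weilOrbitClass p 𝔭 τ₀ h (isCMTypeWith_repType p 𝔭 τ₀ h c) =
      weilOrbitClass p 𝔭 τ₀ h (isCMTypeWith_repTypeL p 𝔭 τ₀ h (CosetGerm.redI ℤ h c)) := by
  rw [weilOrbitClass_repTypeL]
  exact congrArg (CosetGerm.redI ℤ h) (cmOrbitClass_repType p 𝔭 τ₀ h c)

/-- The two model readings of `X^*(L^{Π(Ψ_c)})(K)` (from `π(Φ_c)` and from `ϖ_{π(c)}`) differ by the re-indexing along
`weilOrbitClass_repType_eq`. [cite: Milne1999, §6 p. 71 L17] -/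
theorem weilOrbitCharEquivModel_germCast (c : CMOrbits h) (w : weilOrbitChar ℤ (cmTypeGerm p 𝔭 (isCMTypeWith_repType p 𝔭 τ₀ h c))) :
    weilOrbitCharEquivModel p 𝔭 τ₀ h (isCMTypeWith_repTypeL p 𝔭 τ₀ h (CosetGerm.redI ℤ h c)) (germCast p 𝔭 τ₀ h c w) =
      charModuleCongr ℤ (conjGal : K ≃ₐ[ℚ] K) (weilOrbitClass_repType_eq p 𝔭 τ₀ h c)
        (weilOrbitCharEquivModel p 𝔭 τ₀ h (isCMTypeWith_repType p 𝔭 τ₀ h c) w) := by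
  have key : (weilOrbitCharEquivModel p 𝔭 τ₀ h (isCMTypeWith_repTypeL p 𝔭 τ₀ h (CosetGerm.redI ℤ h c))).toLinearMap ∘ₗ
      (germCast p 𝔭 τ₀ h c).toLinearMap = (charModuleCongr ℤ (conjGal : K ≃ₐ[ℚ] K) (weilOrbitClass_repType_eq p 𝔭 τ₀ h c)).toLinearMap ∘ₗ
        (weilOrbitCharEquivModel p 𝔭 τ₀ h (isCMTypeWith_repType p 𝔭 τ₀ h c)).toLinearMap := by
    refine Submodule.linearMap_qext _ (Finsupp.lhom_ext' fun π => LinearMap.ext_ring ?_)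
    change weilOrbitCharEquivModel p 𝔭 τ₀ h _ (germCast p 𝔭 τ₀ h c (Submodule.Quotient.mk (Finsupp.single π (1 : ℤ)))) =
      charModuleCongr ℤ (conjGal : K ≃ₐ[ℚ] K) _ (weilOrbitCharEquivModel p 𝔭 τ₀ h _ (Submodule.Quotient.mk (Finsupp.single π (1 : ℤ))))
    rw [germCast_mk_single, weilOrbitCharEquivModel_mk_single, weilOrbitCharEquivModel_mk_single, OrbitTorus.charModuleCongr_mk_single]
    rfl
  exact LinearMap.congr_fun key w

/-- **The summand of `X^*(α′)(K)` at `c` matches the model's**: `X^*(T^{Ψ_c})(K) → X^*(L^{Π(Ψ_c)})(K) = X^*(L^{Π_{π(c)}})(K) ≅ X^*(L^{π(c)})` is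
`pushOrbit c` after `X^*(T^{Ψ_c})(K) ≅ X^*(T^c)` (g18-#6 `weilOrbitCharEquivModel_redChar`, re-indexed). [cite: Milne1999, §6 p. 71 L16–L17, L22–L23] -/
theorem lComp_germCast_redChar (c : CMOrbits h) (z : cmOrbitChar ℤ (repType p 𝔭 τ₀ h c)) :
    lComp p 𝔭 τ₀ h (CosetGerm.redI ℤ h c) (germCast p 𝔭 τ₀ h c (redChar p 𝔭 (isCMTypeWith_repType p 𝔭 τ₀ h c) z)) =
      CosetGerm.pushOrbit ℤ h c (tComp p 𝔭 τ₀ h c z) := by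
  change charModuleCongr ℤ (conjGal : K ≃ₐ[ℚ] K) (weilOrbitClass_repTypeL p 𝔭 τ₀ h (CosetGerm.redI ℤ h c))
      (weilOrbitCharEquivModel p 𝔭 τ₀ h (isCMTypeWith_repTypeL p 𝔭 τ₀ h (CosetGerm.redI ℤ h c))
        (germCast p 𝔭 τ₀ h c (redChar p 𝔭 (isCMTypeWith_repType p 𝔭 τ₀ h c) z))) =
      CosetGerm.pushOrbit ℤ h c (charModuleCongr ℤ (conjGal : K ≃ₐ[ℚ] K) (cmOrbitClass_repType p 𝔭 τ₀ h c)
        (cmOrbitCharEquivModel τ₀ h (isCMTypeWith_repType p 𝔭 τ₀ h c) z))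
  rw [weilOrbitCharEquivModel_germCast, weilOrbitCharEquivModel_redChar, CosetGerm.pushOrbit_charModuleCongr,
    OrbitTorus.charModuleCongr_charModuleCongr]
  rfl

end GermCast

/-! ### §4 `X^*(T^K)(K)`, `X^*(L^K)(K)` as products of pairs of `K`'s own orbit tori, and the right-hand square for `K` -/

section PairProductK

variable {K : Type} [Field K] [NumberField K] [IsCMField K] [IsGalois ℚ K]
variable (p : ℕ) [hp : Fact p.Prime] (𝔭 : Ideal (𝓞 K)) [h𝔭P : 𝔭.IsPrime] [h𝔭 : 𝔭.LiesOver (Ideal.span {(p : ℤ)})]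
variable (τ₀ : K →ₐ[ℚ] cmNumbers)
variable {Γ₀ : Subgroup (K ≃ₐ[ℚ] K)} (h : Setting (conjGal : K ≃ₐ[ℚ] K) Γ₀ (decompositionGroup p 𝔭)) [DecidableEq (K ≃ₐ[ℚ] K)]

/-- **The family `(X^*(T^Ψ), t^Ψ)_{Ψ∈I}` of `K`** (at the representatives `Φ_c`): `t^{Ψ_c} = tCM`. [cite: Milne1999, Thm 2.6 p. 56; §1 p. 48
L31–L35] -/
def tFamK : ∀ c : CMOrbits h, cmOrbitChar ℤ (repType p 𝔭 τ₀ h c) := fun c => tCM ℤ (repType p 𝔭 τ₀ h c)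

/-- **`X^*(T^K)(K) = X^*(∏_{Ψ∈I} (T^Ψ, t^Ψ))`** built from `K`'s own orbit tori (THEOREM 2.6 read on characters). [cite: Milne1999, Thm 2.6 p. 56;
§1 p. 48 L31–L35] -/
abbrev TKK : Type _ := PairProduct.Amalg ℤ (tFamK p 𝔭 τ₀ h)

/-- **The family `(X^*(L^Π), l^Π)_{Π∈I′}` of `K`** (at the representatives `ϖ_{c′}`): `l^{Π_{c′}} = lWeil`. [cite: Milne1999, §4 p. 62 L15–L16;
§1 p. 48 L31–L35] -/
def lFamK : ∀ c' : WeilOrbits ℤ h, weilOrbitChar ℤ (repGerm p 𝔭 τ₀ h c') := fun c' => lWeil ℤ (repGerm p 𝔭 τ₀ h c')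

/-- **`X^*(L^K)(K) = X^*(∏_{Π∈I′} (L^Π, l^Π))`** built from `K`'s own Weil orbit tori (THEOREM 4.3 / §4 p. 62 read on characters).
[cite: Milne1999, §4 p. 62 L15–L16; §1 p. 48 L31–L35] -/
abbrev LKK : Type _ := PairProduct.Amalg ℤ (lFamK p 𝔭 τ₀ h)

/-- **`X^*(T^K)(K) ≅ X^*(T^K)` (model, g17-#5 `TK`)**, summand by summand by §2. [cite: Milne1999, Thm 2.6 p. 56; §6 p. 71 L22] -/
def tKEquiv : TKK p 𝔭 τ₀ h ≃ₗ[ℤ] CosetGerm.TK ℤ h :=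
  PairProduct.congrOf ℤ (tFamK p 𝔭 τ₀ h) (CosetGerm.tFam ℤ h) (tComp p 𝔭 τ₀ h) (tComp_tCM p 𝔭 τ₀ h)

omit hp in
/-- [cite: Milne1999, §6 p. 71 L22] -/
theorem tKEquiv_mk (x : ∀ c : CMOrbits h, cmOrbitChar ℤ (repType p 𝔭 τ₀ h c)) :
    tKEquiv p 𝔭 τ₀ h (Submodule.Quotient.mk x) = Submodule.Quotient.mk (fun c => tComp p 𝔭 τ₀ h c (x c)) := rfl

/-- **`X^*(L^K)(K) ≅ X^*(L^K)` (model, g17-#5 `LK`)**, summand by summand by §2. [cite: Milne1999, §4 p. 62 L15–L16; §6 p. 71 L23] -/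
def lKEquiv : LKK p 𝔭 τ₀ h ≃ₗ[ℤ] CosetGerm.LK ℤ h :=
  PairProduct.congrOf ℤ (lFamK p 𝔭 τ₀ h) (CosetGerm.lFam ℤ h) (lComp p 𝔭 τ₀ h) (lComp_lWeil p 𝔭 τ₀ h)

/-- [cite: Milne1999, §6 p. 71 L23] -/
theorem lKEquiv_mk (y : ∀ c' : WeilOrbits ℤ h, weilOrbitChar ℤ (repGerm p 𝔭 τ₀ h c')) :
    lKEquiv p 𝔭 τ₀ h (Submodule.Quotient.mk y) = Submodule.Quotient.mk (fun c' => lComp p 𝔭 τ₀ h c' (y c')) := rfl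

omit hp in
/-- `tKEquiv` on a single summand. [cite: Milne1999, §6 p. 71 L22] -/
theorem tKEquiv_mk_single (c : CMOrbits h) (x : cmOrbitChar ℤ (repType p 𝔭 τ₀ h c)) :
    tKEquiv p 𝔭 τ₀ h (Submodule.Quotient.mk (Pi.single c x)) = Submodule.Quotient.mk (Pi.single c (tComp p 𝔭 τ₀ h c x)) :=
  PairProduct.congrOf_mk_single ℤ (tFamK p 𝔭 τ₀ h) (CosetGerm.tFam ℤ h) (tComp p 𝔭 τ₀ h) (tComp_tCM p 𝔭 τ₀ h) c x

/-- `lKEquiv` on a single summand. [cite: Milne1999, §6 p. 71 L23] -/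
theorem lKEquiv_mk_single (c' : WeilOrbits ℤ h) (y : weilOrbitChar ℤ (repGerm p 𝔭 τ₀ h c')) :
    lKEquiv p 𝔭 τ₀ h (Submodule.Quotient.mk (Pi.single c' y)) = Submodule.Quotient.mk (Pi.single c' (lComp p 𝔭 τ₀ h c' y)) :=
  PairProduct.congrOf_mk_single ℤ (lFamK p 𝔭 τ₀ h) (CosetGerm.lFam ℤ h) (lComp p 𝔭 τ₀ h) (lComp_lWeil p 𝔭 τ₀ h) c' y

/-- **`γ` for `K`: `⊕_{Ψ∈I} X^*(T^Ψ)(K) → X^*(S^K)(K)`**, `Σ_c X^*(γ^{Ψ_c})` (g16-#7 `gammaCharK`). [cite: Milne1999, §6 p. 71 L16; §3 p. 59 L1–L8] -/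
def tSumKToS : (∀ c : CMOrbits h, cmOrbitChar ℤ (repType p 𝔭 τ₀ h c)) →ₗ[ℤ]
    infinityTypes (cmNumbers ≃ₐ[ℚ] cmNumbers) (K →ₐ[ℚ] cmNumbers) cmNumbersConj :=
  ∑ c : CMOrbits h, (gammaCharK (isCMTypeWith_repType p 𝔭 τ₀ h c)).comp (LinearMap.proj c)

omit hp in
/-- On a single summand. [cite: Milne1999, §6 p. 71 L16] -/
theorem tSumKToS_single (c : CMOrbits h) (x : cmOrbitChar ℤ (repType p 𝔭 τ₀ h c)) :
    tSumKToS p 𝔭 τ₀ h (Pi.single c x) = gammaCharK (isCMTypeWith_repType p 𝔭 τ₀ h c) x := by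
  rw [tSumKToS, LinearMap.sum_apply]
  refine (Finset.sum_eq_single c (fun c' _ hc' => ?_) (fun hc => absurd (Finset.mem_univ c) hc)).trans ?_
  · change gammaCharK (isCMTypeWith_repType p 𝔭 τ₀ h c') (Pi.single (M := fun c => cmOrbitChar ℤ (repType p 𝔭 τ₀ h c)) c x c') = 0
    rw [Pi.single_eq_of_ne hc']
    exact map_zero _
  · change gammaCharK (isCMTypeWith_repType p 𝔭 τ₀ h c) (Pi.single (M := fun c => cmOrbitChar ℤ (repType p 𝔭 τ₀ h c)) c x c) = _
    rw [Pi.single_eq_same]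

omit hp in
/-- Every `t^{Ψ_c}` goes to `s = 1` («its composite with `t^Ψ` is `s`»). [cite: Milne1999, §3 p. 59 L5–L6] -/
theorem tSumKToS_single_tFamK (c : CMOrbits h) :
    tSumKToS p 𝔭 τ₀ h (Pi.single c (tFamK p 𝔭 τ₀ h c)) = constChar (cmNumbers ≃ₐ[ℚ] cmNumbers) (K →ₐ[ℚ] cmNumbers) cmNumbersConj 1 := by
  rw [tSumKToS_single]
  exact gammaCharK_tCM _

/-- **`X^*(T^K)(K) → X^*(S^K)(K)`** (top arrow of the right-hand square for `K`), induced by `γ`. [cite: Milne1999, §6 p. 68 L106–L118, p. 71 L22] -/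
def tKKToS : TKK p 𝔭 τ₀ h →ₗ[ℤ] infinityTypes (cmNumbers ≃ₐ[ℚ] cmNumbers) (K →ₐ[ℚ] cmNumbers) cmNumbersConj :=
  PairProduct.liftOf ℤ (tFamK p 𝔭 τ₀ h) (tSumKToS p 𝔭 τ₀ h) fun c c' => by rw [tSumKToS_single_tFamK, tSumKToS_single_tFamK]

omit hp in
/-- [cite: Milne1999, §6 p. 71 L22] -/
theorem tKKToS_mk (x : ∀ c : CMOrbits h, cmOrbitChar ℤ (repType p 𝔭 τ₀ h c)) :
    tKKToS p 𝔭 τ₀ h (Submodule.Quotient.mk x) = tSumKToS p 𝔭 τ₀ h x := rfl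

/-- `ϖ_{c′} ∈ W^K_{1,+}(p^∞)`. [cite: Milne1999, §4 p. 62 L15–L16] -/
theorem repGerm_mem (c' : WeilOrbits ℤ h) : repGerm p 𝔭 τ₀ h c' ∈ weilLimitInOnePlus K p τ₀ :=
  cmTypeGerm_mem_weilLimitInOnePlus p 𝔭 τ₀ (isCMTypeWith_repTypeL p 𝔭 τ₀ h c')

/-- **`β` for `K`: `⊕_{Π∈I′} X^*(L^Π)(K) → X^*(P^K)(K)`**, `Σ_{c′} X^*(β^{Π_{c′}})` (g16-#7 `betaCharIn`). [cite: Milne1999, §6 p. 71 L17; §4 p. 62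
L17–L19] -/
def lSumKToP : (∀ c' : WeilOrbits ℤ h, weilOrbitChar ℤ (repGerm p 𝔭 τ₀ h c')) →ₗ[ℤ] Additive (weilLimitIn K p τ₀) :=
  ∑ c' : WeilOrbits ℤ h, (betaCharIn p τ₀ (repGerm p 𝔭 τ₀ h c') (repGerm_mem p 𝔭 τ₀ h c')).comp (LinearMap.proj c')

/-- On a single summand. [cite: Milne1999, §6 p. 71 L17] -/
theorem lSumKToP_single (c' : WeilOrbits ℤ h) (y : weilOrbitChar ℤ (repGerm p 𝔭 τ₀ h c')) :
    lSumKToP p 𝔭 τ₀ h (Pi.single c' y) = betaCharIn p τ₀ (repGerm p 𝔭 τ₀ h c') (repGerm_mem p 𝔭 τ₀ h c') y := by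
  rw [lSumKToP, LinearMap.sum_apply]
  refine (Finset.sum_eq_single c' (fun c'' _ hc'' => ?_) (fun hc => absurd (Finset.mem_univ c') hc)).trans ?_
  · change betaCharIn p τ₀ (repGerm p 𝔭 τ₀ h c'') (repGerm_mem p 𝔭 τ₀ h c'')
      (Pi.single (M := fun c' => weilOrbitChar ℤ (repGerm p 𝔭 τ₀ h c')) c' y c'') = 0
    rw [Pi.single_eq_of_ne hc'']
    exact map_zero _
  · change betaCharIn p τ₀ (repGerm p 𝔭 τ₀ h c') (repGerm_mem p 𝔭 τ₀ h c')
      (Pi.single (M := fun c' => weilOrbitChar ℤ (repGerm p 𝔭 τ₀ h c')) c' y c') = _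
    rw [Pi.single_eq_same]

/-- Every `l^{Π_{c′}}` goes to `p^K` («This map sends `p^K` to `l^Π`», dually; g16-#7 `betaCharIn_lWeil`). [cite: Milne1999, §4 p. 62 L24–L27] -/
theorem lSumKToP_single_lFamK (c' : WeilOrbits ℤ h) :
    lSumKToP p 𝔭 τ₀ h (Pi.single c' (lFamK p 𝔭 τ₀ h c')) = Additive.ofMul (pGermIn p τ₀) := by
  rw [lSumKToP_single]
  exact betaCharIn_lWeil p τ₀ _ _

/-- **`X^*(L^K)(K) → X^*(P^K)(K)`** (bottom arrow of the right-hand square for `K`), induced by `β`. [cite: Milne1999, §6 p. 68 L106–L118, p. 71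
L23] -/
def lKKToP : LKK p 𝔭 τ₀ h →ₗ[ℤ] Additive (weilLimitIn K p τ₀) :=
  PairProduct.liftOf ℤ (lFamK p 𝔭 τ₀ h) (lSumKToP p 𝔭 τ₀ h) fun c c' => by rw [lSumKToP_single_lFamK, lSumKToP_single_lFamK]

/-- [cite: Milne1999, §6 p. 71 L23] -/
theorem lKKToP_mk (y : ∀ c' : WeilOrbits ℤ h, weilOrbitChar ℤ (repGerm p 𝔭 τ₀ h c')) :
    lKKToP p 𝔭 τ₀ h (Submodule.Quotient.mk y) = lSumKToP p 𝔭 τ₀ h y := rfl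

/-- **`α″` for `K`: `⊕_{Ψ∈I} X^*(T^Ψ)(K) → ⊕_{Π∈I′} X^*(L^Π)(K)`**, on the summand of `c` the map `X^*(T^{Ψ_c}) → X^*(L^{Π(Ψ_c)}) = X^*(L^{Π_{π(c)}})`
(g16-#6 `redChar`, then §3's `germCast`) placed at `π(c) = redI c`. [cite: Milne1999, §6 p. 71 L16–L17, L22–L23; §5 Thm 5.4 p. 65] -/
def alphaSumK : (∀ c : CMOrbits h, cmOrbitChar ℤ (repType p 𝔭 τ₀ h c)) →ₗ[ℤ] (∀ c' : WeilOrbits ℤ h, weilOrbitChar ℤ (repGerm p 𝔭 τ₀ h c')) :=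
  ∑ c : CMOrbits h, (LinearMap.single ℤ (fun c' : WeilOrbits ℤ h => weilOrbitChar ℤ (repGerm p 𝔭 τ₀ h c')) (CosetGerm.redI ℤ h c)).comp
    ((germCast p 𝔭 τ₀ h c).toLinearMap.comp ((redChar p 𝔭 (isCMTypeWith_repType p 𝔭 τ₀ h c)).comp (LinearMap.proj c)))

/-- On a single summand. [cite: Milne1999, §6 p. 71 L16–L17] -/
theorem alphaSumK_single (c : CMOrbits h) (z : cmOrbitChar ℤ (repType p 𝔭 τ₀ h c)) :
    alphaSumK p 𝔭 τ₀ h (Pi.single c z) =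
      Pi.single (CosetGerm.redI ℤ h c) (germCast p 𝔭 τ₀ h c (redChar p 𝔭 (isCMTypeWith_repType p 𝔭 τ₀ h c) z)) := by
  rw [alphaSumK, LinearMap.sum_apply]
  refine (Finset.sum_eq_single c (fun c'' _ hc'' => ?_) (fun hc => absurd (Finset.mem_univ c) hc)).trans ?_
  · have h0 : redChar p 𝔭 (isCMTypeWith_repType p 𝔭 τ₀ h c'')
        (Pi.single (M := fun c => cmOrbitChar ℤ (repType p 𝔭 τ₀ h c)) c z c'') = 0 := by
      rw [Pi.single_eq_of_ne hc'']
      exact map_zero _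
    have h1 : germCast p 𝔭 τ₀ h c'' (redChar p 𝔭 (isCMTypeWith_repType p 𝔭 τ₀ h c'')
        (Pi.single (M := fun c => cmOrbitChar ℤ (repType p 𝔭 τ₀ h c)) c z c'')) = 0 := by
      rw [h0]
      exact map_zero _
    change Pi.single (M := fun c' : WeilOrbits ℤ h => weilOrbitChar ℤ (repGerm p 𝔭 τ₀ h c')) (CosetGerm.redI ℤ h c'')
      (germCast p 𝔭 τ₀ h c'' (redChar p 𝔭 (isCMTypeWith_repType p 𝔭 τ₀ h c'')
        (Pi.single (M := fun c => cmOrbitChar ℤ (repType p 𝔭 τ₀ h c)) c z c''))) = 0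
    rw [h1]
    exact Pi.single_zero _
  · change Pi.single (M := fun c' : WeilOrbits ℤ h => weilOrbitChar ℤ (repGerm p 𝔭 τ₀ h c')) (CosetGerm.redI ℤ h c)
      (germCast p 𝔭 τ₀ h c (redChar p 𝔭 (isCMTypeWith_repType p 𝔭 τ₀ h c)
        (Pi.single (M := fun c => cmOrbitChar ℤ (repType p 𝔭 τ₀ h c)) c z c))) = _
    rw [Pi.single_eq_same]

/-- `α″(δ_c t^{Ψ_c}) = δ_{π(c)} l^{Π_{π(c)}}` («sending `t^Ψ` to `l^Π`»). [cite: Milne1999, §5 p. 65; §6 p. 71 L22–L23] -/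
theorem alphaSumK_single_tFamK (c : CMOrbits h) :
    alphaSumK p 𝔭 τ₀ h (Pi.single c (tFamK p 𝔭 τ₀ h c)) = Pi.single (CosetGerm.redI ℤ h c) (lFamK p 𝔭 τ₀ h (CosetGerm.redI ℤ h c)) := by
  rw [alphaSumK_single]
  exact congrArg (Pi.single (M := fun c' : WeilOrbits ℤ h => weilOrbitChar ℤ (repGerm p 𝔭 τ₀ h c')) (CosetGerm.redI ℤ h c))
    ((congrArg (germCast p 𝔭 τ₀ h c) (redChar_tCM p 𝔭 (isCMTypeWith_repType p 𝔭 τ₀ h c))).trans (germCast_lWeil p 𝔭 τ₀ h c))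

/-- **`X^*(α′)(K) : X^*(T^K)(K) → X^*(L^K)(K)`** (left arrow of the right-hand square for `K`), induced by `α″` summand by summand.
[cite: Milne1999, §6 p. 71 L22–L23; §5 Thm 5.4 p. 65] -/
def alphaKK : TKK p 𝔭 τ₀ h →ₗ[ℤ] LKK p 𝔭 τ₀ h :=
  PairProduct.mapOf ℤ (tFamK p 𝔭 τ₀ h) (lFamK p 𝔭 τ₀ h) (alphaSumK p 𝔭 τ₀ h) fun c c₂ => by
    rw [alphaSumK_single_tFamK, alphaSumK_single_tFamK]
    exact PairProduct.single_sub_single_mem ℤ _ _ _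

/-- [cite: Milne1999, §6 p. 71 L22–L23] -/
theorem alphaKK_mk (x : ∀ c : CMOrbits h, cmOrbitChar ℤ (repType p 𝔭 τ₀ h c)) :
    alphaKK p 𝔭 τ₀ h (Submodule.Quotient.mk x) = Submodule.Quotient.mk (alphaSumK p 𝔭 τ₀ h x) := rfl

/-! ### §5 The three arrows of `K` are the model's, along `tKEquiv`, `lKEquiv`, `serreLatticeEquiv`, `weilLatticeEquiv` -/

omit hp in
/-- `γ` of `K` through `X^*(S^K)(K) ↪ ℤ[Γ]` is the model's `γ` (g18-#6 `toGroupRing_gammaCharK`, summand by summand). [cite: Milne1999, §6 p. 71 L16] -/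
theorem toGroupRing_tSumKToS (x : ∀ c : CMOrbits h, cmOrbitChar ℤ (repType p 𝔭 τ₀ h c)) :
    toGroupRing τ₀ ((tSumKToS p 𝔭 τ₀ h x : infinityTypes (cmNumbers ≃ₐ[ℚ] cmNumbers) (K →ₐ[ℚ] cmNumbers) cmNumbersConj) :
      (K →ₐ[ℚ] cmNumbers) → ℤ) = CosetGerm.tSumToS ℤ h two_ne_zero (fun c => tComp p 𝔭 τ₀ h c (x c)) := by
  have hAB : (toGroupRing τ₀).comp ((infinityTypes (cmNumbers ≃ₐ[ℚ] cmNumbers) (K →ₐ[ℚ] cmNumbers) cmNumbersConj).subtype.comp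
      (tSumKToS p 𝔭 τ₀ h)) = (CosetGerm.tSumToS ℤ h two_ne_zero).comp (LinearEquiv.piCongrRight (tComp p 𝔭 τ₀ h)).toLinearMap := by
    refine LinearMap.pi_ext fun c z => ?_
    change toGroupRing τ₀ ((tSumKToS p 𝔭 τ₀ h (Pi.single c z) : infinityTypes (cmNumbers ≃ₐ[ℚ] cmNumbers) (K →ₐ[ℚ] cmNumbers)
      cmNumbersConj) : (K →ₐ[ℚ] cmNumbers) → ℤ) =
      CosetGerm.tSumToS ℤ h two_ne_zero (LinearEquiv.piCongrRight (tComp p 𝔭 τ₀ h) (Pi.single c z))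
    rw [tSumKToS_single, PairProduct.piCongrRight_single, CosetGerm.tSumToS_single, toGroupRing_gammaCharK τ₀ h]
    exact (CosetGerm.orbitToS_charModuleCongr ℤ h two_ne_zero (cmOrbitClass_repType p 𝔭 τ₀ h c) _).symm
  exact LinearMap.congr_fun hAB x

omit hp in
/-- **The top arrow of `K` is the model's**: `serreLatticeEquiv ∘ (X^*(T^K)(K) → X^*(S^K)(K)) = tKToS ∘ tKEquiv`. [cite: Milne1999, §6 p. 71 L22] -/
theorem serreLatticeEquiv_tKKToS (x : TKK p 𝔭 τ₀ h) :
    serreLatticeEquiv τ₀ (tKKToS p 𝔭 τ₀ h x) = CosetGerm.tKToS ℤ h two_ne_zero (tKEquiv p 𝔭 τ₀ h x) := by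
  induction x using Submodule.Quotient.induction_on with | H x => ?_
  apply Subtype.ext
  rw [coe_serreLatticeEquiv]
  change toGroupRing τ₀ ((tSumKToS p 𝔭 τ₀ h x : infinityTypes (cmNumbers ≃ₐ[ℚ] cmNumbers) (K →ₐ[ℚ] cmNumbers) cmNumbersConj) :
      (K →ₐ[ℚ] cmNumbers) → ℤ) = (CosetGerm.tSumToSs ℤ h two_ne_zero (fun c => tComp p 𝔭 τ₀ h c (x c)) : (K ≃ₐ[ℚ] K) →₀ ℤ)
  rw [CosetGerm.coe_tSumToSs]
  exact toGroupRing_tSumKToS p 𝔭 τ₀ h x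

/-- `β` of `K` through `X^*(P^K)(K) ↪ ℤ[Γ/D]` is the model's `β` (g18-#6 `germToCosetFun_betaCharIn_eq_orbitToP`, summand by summand).
[cite: Milne1999, §6 p. 71 L17] -/
theorem germToCosetFun_lSumKToP (y : ∀ c' : WeilOrbits ℤ h, weilOrbitChar ℤ (repGerm p 𝔭 τ₀ h c')) :
    germToCosetFun p 𝔭 τ₀ (lSumKToP p 𝔭 τ₀ h y) = CosetGerm.lSumToP ℤ h two_ne_zero (fun c' => lComp p 𝔭 τ₀ h c' (y c')) := by
  have hAB : (germToCosetFun p 𝔭 τ₀).comp (lSumKToP p 𝔭 τ₀ h) =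
      (CosetGerm.lSumToP ℤ h two_ne_zero).comp (LinearEquiv.piCongrRight (lComp p 𝔭 τ₀ h)).toLinearMap := by
    refine LinearMap.pi_ext fun c' z => ?_
    change germToCosetFun p 𝔭 τ₀ (lSumKToP p 𝔭 τ₀ h (Pi.single c' z)) =
      CosetGerm.lSumToP ℤ h two_ne_zero (LinearEquiv.piCongrRight (lComp p 𝔭 τ₀ h) (Pi.single c' z))
    rw [lSumKToP_single, PairProduct.piCongrRight_single, CosetGerm.lSumToP_single]
    exact (germToCosetFun_betaCharIn_eq_orbitToP p 𝔭 τ₀ h (isCMTypeWith_repTypeL p 𝔭 τ₀ h c') z).trans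
      (CosetGerm.orbitToP_charModuleCongr ℤ h two_ne_zero (weilOrbitClass_repTypeL p 𝔭 τ₀ h c') _).symm
  exact LinearMap.congr_fun hAB y

/-- **The bottom arrow of `K` is the model's**: `weilLatticeEquiv ∘ (X^*(L^K)(K) → X^*(P^K)(K)) = lKToP ∘ lKEquiv`. [cite: Milne1999, §6 p. 71 L23] -/
theorem weilLatticeEquiv_lKKToP (y : LKK p 𝔭 τ₀ h) :
    weilLatticeEquiv p 𝔭 τ₀ (lKKToP p 𝔭 τ₀ h y) = CosetGerm.lKToP ℤ h two_ne_zero (lKEquiv p 𝔭 τ₀ h y) := by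
  induction y using Submodule.Quotient.induction_on with | H y => ?_
  apply Subtype.ext
  rw [coe_weilLatticeEquiv]
  change germToCosetFun p 𝔭 τ₀ (lSumKToP p 𝔭 τ₀ h y) =
    (CosetGerm.lSumToPw ℤ h two_ne_zero (fun c' => lComp p 𝔭 τ₀ h c' (y c')) : (K ≃ₐ[ℚ] K) ⧸ decompositionGroup p 𝔭 →₀ ℤ)
  rw [CosetGerm.coe_lSumToPw]
  exact germToCosetFun_lSumKToP p 𝔭 τ₀ h y

/-- `α″` of `K` is the model's `α″` (§3 `lComp_germCast_redChar`, summand by summand). [cite: Milne1999, §6 p. 71 L22–L23] -/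
theorem lComp_alphaSumK (x : ∀ c : CMOrbits h, cmOrbitChar ℤ (repType p 𝔭 τ₀ h c)) :
    (fun c' => lComp p 𝔭 τ₀ h c' (alphaSumK p 𝔭 τ₀ h x c')) = CosetGerm.alphaSum ℤ h (fun c => tComp p 𝔭 τ₀ h c (x c)) := by
  have hAB : (LinearEquiv.piCongrRight (lComp p 𝔭 τ₀ h)).toLinearMap.comp (alphaSumK p 𝔭 τ₀ h) =
      (CosetGerm.alphaSum ℤ h).comp (LinearEquiv.piCongrRight (tComp p 𝔭 τ₀ h)).toLinearMap := by
    refine LinearMap.pi_ext fun c z => ?_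
    change LinearEquiv.piCongrRight (lComp p 𝔭 τ₀ h) (alphaSumK p 𝔭 τ₀ h (Pi.single c z)) =
      CosetGerm.alphaSum ℤ h (LinearEquiv.piCongrRight (tComp p 𝔭 τ₀ h) (Pi.single c z))
    rw [alphaSumK_single, PairProduct.piCongrRight_single, PairProduct.piCongrRight_single, CosetGerm.alphaSum_single]
    exact congrArg (Pi.single (CosetGerm.redI ℤ h c)) (lComp_germCast_redChar p 𝔭 τ₀ h c z)
  exact LinearMap.congr_fun hAB x

/-- **The left arrow of `K` is the model's**: `lKEquiv ∘ X^*(α′)(K) = alphaK ∘ tKEquiv`. [cite: Milne1999, §6 p. 71 L22–L23] -/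
theorem lKEquiv_alphaKK (x : TKK p 𝔭 τ₀ h) :
    lKEquiv p 𝔭 τ₀ h (alphaKK p 𝔭 τ₀ h x) = CosetGerm.alphaK ℤ h (tKEquiv p 𝔭 τ₀ h x) := by
  induction x using Submodule.Quotient.induction_on with | H x => ?_
  change Submodule.Quotient.mk (fun c' => lComp p 𝔭 τ₀ h c' (alphaSumK p 𝔭 τ₀ h x c')) =
    Submodule.Quotient.mk (CosetGerm.alphaSum ℤ h (fun c => tComp p 𝔭 τ₀ h c (x c)))
  rw [lComp_alphaSumK]

/-- The right-hand square of `K` commutes: `X^*(α)(K) ∘ (X^*(T^K)(K) → X^*(S^K)(K)) = (X^*(L^K)(K) → X^*(P^K)(K)) ∘ X^*(α′)(K)`.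
[cite: Milne1999, §6 p. 71 L22–L23; §5 Lemma 5.1] -/
theorem pairProductK_square_comm [DecidablePred (· ∈ Γ₀)] [DecidablePred (· ∈ decompositionGroup p 𝔭)] (x : TKK p 𝔭 τ₀ h) :
    alphaCharIn p 𝔭 τ₀ (tKKToS p 𝔭 τ₀ h x) = lKKToP p 𝔭 τ₀ h (alphaKK p 𝔭 τ₀ h x) := by
  apply (weilLatticeEquiv p 𝔭 τ₀).injective
  rw [weilLatticeEquiv_alphaCharIn, serreLatticeEquiv_tKKToS, weilLatticeEquiv_lKKToP, lKEquiv_alphaKK]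
  exact CosetGerm.pairProduct_square_comm ℤ h two_ne_zero _

/-! ### §6 LEMMA 6.10 and the right-hand square for `K`; THEOREM 6.1 at level `K`, read on characters, with `K`'s own four vertices -/

omit hp in
/-- `γ` of `K` through `serreLatticeEquiv` is the model's `γ` after `⊕_c tComp`. [cite: Milne1999, §6 p. 71 L16] -/
theorem serreLatticeEquiv_tSumKToS (x : ∀ c : CMOrbits h, cmOrbitChar ℤ (repType p 𝔭 τ₀ h c)) :
    serreLatticeEquiv τ₀ (tSumKToS p 𝔭 τ₀ h x) = CosetGerm.tSumToSs ℤ h two_ne_zero (LinearEquiv.piCongrRight (tComp p 𝔭 τ₀ h) x) :=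
  Subtype.ext (by rw [coe_serreLatticeEquiv, CosetGerm.coe_tSumToSs]; exact toGroupRing_tSumKToS p 𝔭 τ₀ h x)

/-- `β` of `K` through `weilLatticeEquiv` is the model's `β` after `⊕_{c′} lComp`. [cite: Milne1999, §6 p. 71 L17] -/
theorem weilLatticeEquiv_lSumKToP (y : ∀ c' : WeilOrbits ℤ h, weilOrbitChar ℤ (repGerm p 𝔭 τ₀ h c')) :
    weilLatticeEquiv p 𝔭 τ₀ (lSumKToP p 𝔭 τ₀ h y) = CosetGerm.lSumToPw ℤ h two_ne_zero (LinearEquiv.piCongrRight (lComp p 𝔭 τ₀ h) y) :=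
  Subtype.ext (by rw [coe_weilLatticeEquiv, CosetGerm.coe_lSumToPw]; exact germToCosetFun_lSumKToP p 𝔭 τ₀ h y)

/-- `α″` of `K` is the model's `α″` along `⊕ tComp`, `⊕ lComp`. [cite: Milne1999, §6 p. 71 L16–L17] -/
theorem piCongrRight_alphaSumK (x : ∀ c : CMOrbits h, cmOrbitChar ℤ (repType p 𝔭 τ₀ h c)) :
    LinearEquiv.piCongrRight (lComp p 𝔭 τ₀ h) (alphaSumK p 𝔭 τ₀ h x) =
      CosetGerm.alphaSum ℤ h (LinearEquiv.piCongrRight (tComp p 𝔭 τ₀ h) x) :=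
  lComp_alphaSumK p 𝔭 τ₀ h x

/-- **LEMMA 6.10 FOR THE CM FIELD `K` ITSELF**: the square `⊕_{Ψ∈I} X^*(T^Ψ)(K) −γ→ X^*(S^K)(K)` over `⊕_{Π∈I′} X^*(L^Π)(K) −β→ X^*(P^K)(K)`
(verticals `α″`, `X^*(α^K)`), built from `K`'s own orbit tori, `gammaCharK`, `betaCharIn`, `redChar`, `alphaCharIn`, is almost cartesian —
g17-#4 `int_isAlmostCartesian_sum` transported along `⊕ tComp`, `⊕ lComp`, `serreLatticeEquiv`, `weilLatticeEquiv`. [cite: Milne1999, §6 p. 71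
L15–L21 (Lemma 6.10)] -/
theorem isAlmostCartesian_sumK [DecidablePred (· ∈ Γ₀)] [DecidablePred (· ∈ decompositionGroup p 𝔭)] :
    IsAlmostCartesian (R := ℤ) (alphaSumK p 𝔭 τ₀ h) (tSumKToS p 𝔭 τ₀ h) (lSumKToP p 𝔭 τ₀ h) (alphaCharIn p 𝔭 τ₀) :=
  (CosetGerm.int_isAlmostCartesian_sum h).of_equiv (LinearEquiv.piCongrRight (tComp p 𝔭 τ₀ h)) (serreLatticeEquiv τ₀)
    (LinearEquiv.piCongrRight (lComp p 𝔭 τ₀ h)) (weilLatticeEquiv p 𝔭 τ₀) _ _ _ _ (piCongrRight_alphaSumK p 𝔭 τ₀ h)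
    (serreLatticeEquiv_tSumKToS p 𝔭 τ₀ h) (weilLatticeEquiv_lSumKToP p 𝔭 τ₀ h) (weilLatticeEquiv_alphaCharIn p 𝔭 τ₀)

/-- **«Therefore the right hand square is almost Cartesian» FOR THE CM FIELD `K` ITSELF**: the square `X^*(T^K)(K) → X^*(S^K)(K)` over
`X^*(L^K)(K) → X^*(P^K)(K)` (verticals `X^*(α′)(K)`, `X^*(α^K)(K)`), with `K`'s own four vertices, is almost cartesian — g17-#5
`int_isAlmostCartesian_pairProduct` transported along `tKEquiv`, `lKEquiv`, `serreLatticeEquiv`, `weilLatticeEquiv` (§5). This is «It suffices to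
prove that [the square] is almost Cartesian» of p. 68, for every `h : Setting ι Γ₀ D(w₀)` on `Gal(K/ℚ)`. [cite: Milne1999, §6 p. 68 L106–L118,
p. 71 L22 – p. 72 L4] -/
theorem isAlmostCartesian_pairProductK [DecidablePred (· ∈ Γ₀)] [DecidablePred (· ∈ decompositionGroup p 𝔭)] :
    IsAlmostCartesian (R := ℤ) (alphaKK p 𝔭 τ₀ h) (tKKToS p 𝔭 τ₀ h) (lKKToP p 𝔭 τ₀ h) (alphaCharIn p 𝔭 τ₀) :=
  (CosetGerm.int_isAlmostCartesian_pairProduct h).of_equiv (tKEquiv p 𝔭 τ₀ h) (serreLatticeEquiv τ₀) (lKEquiv p 𝔭 τ₀ h)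
    (weilLatticeEquiv p 𝔭 τ₀) _ _ _ _ (lKEquiv_alphaKK p 𝔭 τ₀ h) (serreLatticeEquiv_tKKToS p 𝔭 τ₀ h) (weilLatticeEquiv_lKKToP p 𝔭 τ₀ h)
    (weilLatticeEquiv_alphaCharIn p 𝔭 τ₀)

/-- **MILNE 1999 THEOREM 6.1 AT LEVEL `K` ON CHARACTERS, FOR THE CM FIELD `K` ITSELF: «`P^K = S^K ∩ L^K` (inside `T^K`), or, equivalently,
`P^K → L^K × S^K → T^K` is exact»** read on character groups — with `X^*(T^K)(K) = X^*(∏_{Ψ∈I}(T^Ψ, t^Ψ))` and `X^*(L^K)(K) =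
X^*(∏_{Π∈I′}(L^Π, l^Π))` built from `K`'s OWN orbit tori (g16-#6 `cmOrbitChar`, g15-#3 `weilOrbitChar`), `X^*(S^K)(K) = infinityTypes` (skel-11) and
`X^*(P^K)(K) = X^*(W^K(p^∞))` (g15-#6 `weilLimitIn`): a pair `(y, g) ∈ X^*(L^K)(K) ⊕ X^*(S^K)(K)` satisfies `β(y) = X^*(α^K)(g)` in `X^*(P^K)(K)` iff
it is `(X^*(α′)(x), γ(x))` for some `x ∈ X^*(T^K)(K)` — i.e. `X^*(T^K)(K) → X^*(L^K)(K) ⊕ X^*(S^K)(K) → X^*(P^K)(K)` is exact, for every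
`h : Setting ι Γ₀ D(w₀)` on `Γ = Gal(K/ℚ)` (e.g. g18-#1 `cosetGermSetting`: `K ⊋ Q` Galois CM, `(p)` split in the imaginary quadratic `Q`).
The passage back to the groups `P^K, L^K, S^K, T^K` and the limit over `K` (THEOREM 6.1 as printed) are NOT here. [cite: Milne1999, §6 p. 66
L3–L4 (Theorem 6.1), L13–L17; p. 68 L106–L118; p. 71 L22 – p. 72 L4] -/
theorem exact_pairProductK [DecidablePred (· ∈ Γ₀)] [DecidablePred (· ∈ decompositionGroup p 𝔭)] (y : LKK p 𝔭 τ₀ h)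
    (g : infinityTypes (cmNumbers ≃ₐ[ℚ] cmNumbers) (K →ₐ[ℚ] cmNumbers) cmNumbersConj) :
    lKKToP p 𝔭 τ₀ h y = alphaCharIn p 𝔭 τ₀ g ↔ ∃ x : TKK p 𝔭 τ₀ h, alphaKK p 𝔭 τ₀ h x = y ∧ tKKToS p 𝔭 τ₀ h x = g := by
  constructor
  · exact (isAlmostCartesian_pairProductK p 𝔭 τ₀ h).lift y g
  · rintro ⟨x, rfl, rfl⟩
    exact (isAlmostCartesian_pairProductK p 𝔭 τ₀ h).comm x

/-- **THEOREM 6.1 at level `K` for the fields of p. 68–69**: `K` Galois CM over `ℚ` containing an imaginary quadratic `Q` in which `(p)` splits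
(g18-#1 `cosetGermSetting`: `Γ₀ = Gal(K/Q)`, `D = D(w₀)`). [cite: Milne1999, §6 p. 66 L3–L4 (Theorem 6.1); p. 68 L106–L118 («We shall in fact
prove it under the assumption that `K` – is finite and Galois over `ℚ`, – contains a quadratic imaginary extension `Q` of `ℚ` in which `(p)` splits»)] -/
theorem exact_pairProductK_of_split (Q : IntermediateField ℚ K) (hQ : Module.finrank ℚ Q = 2) (hQi : ¬IsTotallyReal Q)
    (hsplit : ((Ideal.span {(p : ℤ)}).primesOver (𝓞 Q)).ncard = 2) [DecidablePred (· ∈ Q.fixingSubgroup)]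
    [DecidablePred (· ∈ decompositionGroup p 𝔭)] (y : LKK p 𝔭 τ₀ (cosetGermSetting Q p 𝔭 hQ hQi hsplit))
    (g : infinityTypes (cmNumbers ≃ₐ[ℚ] cmNumbers) (K →ₐ[ℚ] cmNumbers) cmNumbersConj) :
    lKKToP p 𝔭 τ₀ (cosetGermSetting Q p 𝔭 hQ hQi hsplit) y = alphaCharIn p 𝔭 τ₀ g ↔
      ∃ x : TKK p 𝔭 τ₀ (cosetGermSetting Q p 𝔭 hQ hQi hsplit), alphaKK p 𝔭 τ₀ (cosetGermSetting Q p 𝔭 hQ hQi hsplit) x = y ∧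
        tKKToS p 𝔭 τ₀ (cosetGermSetting Q p 𝔭 hQ hQi hsplit) x = g :=
  exact_pairProductK p 𝔭 τ₀ (cosetGermSetting Q p 𝔭 hQ hQi hsplit) y g

end PairProductK

/-! ### §7 The distinguished characters: `t^K`, `l^K` and the maps of pairs -/

section PairElements

variable {K : Type} [Field K] [NumberField K] [IsCMField K] [IsGalois ℚ K]
variable (p : ℕ) [hp : Fact p.Prime] (𝔭 : Ideal (𝓞 K)) [h𝔭P : 𝔭.IsPrime] [h𝔭 : 𝔭.LiesOver (Ideal.span {(p : ℤ)})]
variable (τ₀ : K →ₐ[ℚ] cmNumbers)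
variable {Γ₀ : Subgroup (K ≃ₐ[ℚ] K)} (h : Setting (conjGal : K ≃ₐ[ℚ] K) Γ₀ (decompositionGroup p 𝔭)) [DecidableEq (K ≃ₐ[ℚ] K)]
  [DecidablePred (· ∈ Γ₀)]

/-- **`t^K ∈ X^*(T^K)(K)`**, the common class of the `t^{Ψ_c}`. [cite: Milne1999, Thm 2.6 p. 56; §1 p. 48 L31–L35] -/
def tKK : TKK p 𝔭 τ₀ h :=
  Submodule.Quotient.mk (Pi.single (Quotient.mk'' (CosetGerm.psiType h) : CMOrbits h) (tFamK p 𝔭 τ₀ h (Quotient.mk'' (CosetGerm.psiType h))))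

omit hp in
/-- Every `[δ_c t^{Ψ_c}]` is `t^K`. [cite: Milne1999, Thm 2.6 p. 56; §1 p. 48 L31–L35] -/
theorem mk_single_tFamK (c : CMOrbits h) : (Submodule.Quotient.mk (Pi.single c (tFamK p 𝔭 τ₀ h c)) : TKK p 𝔭 τ₀ h) = tKK p 𝔭 τ₀ h :=
  PairProduct.mk_single_eq ℤ (tFamK p 𝔭 τ₀ h) c _

/-- **`l^K ∈ X^*(L^K)(K)`**, the common class of the `l^{Π_{c′}}`. [cite: Milne1999, §4 p. 62 L15–L16; §1 p. 48 L31–L35] -/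
def lKK : LKK p 𝔭 τ₀ h :=
  Submodule.Quotient.mk (Pi.single (CosetGerm.redI ℤ h (Quotient.mk'' (CosetGerm.psiType h)))
    (lFamK p 𝔭 τ₀ h (CosetGerm.redI ℤ h (Quotient.mk'' (CosetGerm.psiType h)))))

/-- Every `[δ_{c′} l^{Π_{c′}}]` is `l^K`. [cite: Milne1999, §4 p. 62 L15–L16; §1 p. 48 L31–L35] -/
theorem mk_single_lFamK (c' : WeilOrbits ℤ h) : (Submodule.Quotient.mk (Pi.single c' (lFamK p 𝔭 τ₀ h c')) : LKK p 𝔭 τ₀ h) = lKK p 𝔭 τ₀ h :=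
  PairProduct.mk_single_eq ℤ (lFamK p 𝔭 τ₀ h) c' _

omit hp in
/-- **`t^K ↦ t^K`** (`tKEquiv` is an isomorphism of pairs). [cite: Milne1999, Thm 2.6 p. 56; §1 p. 48 L31–L35] -/
theorem tKEquiv_tKK : tKEquiv p 𝔭 τ₀ h (tKK p 𝔭 τ₀ h) = CosetGerm.tK ℤ h := by
  change tKEquiv p 𝔭 τ₀ h (Submodule.Quotient.mk (Pi.single _ (tCM ℤ (repType p 𝔭 τ₀ h (Quotient.mk'' (CosetGerm.psiType h)))))) = _
  rw [tKEquiv_mk_single, tComp_tCM]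
  rfl

/-- **`l^K ↦ l^K`** (`lKEquiv` is an isomorphism of pairs). [cite: Milne1999, §4 p. 62 L15–L16; §1 p. 48 L31–L35] -/
theorem lKEquiv_lKK : lKEquiv p 𝔭 τ₀ h (lKK p 𝔭 τ₀ h) = CosetGerm.lK ℤ h := by
  change lKEquiv p 𝔭 τ₀ h (Submodule.Quotient.mk (Pi.single _
    (lWeil ℤ (repGerm p 𝔭 τ₀ h (CosetGerm.redI ℤ h (Quotient.mk'' (CosetGerm.psiType h))))))) = _
  rw [lKEquiv_mk_single, lComp_lWeil]
  rfl

omit hp in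
/-- **`t^K ↦ s = 1`** (a map of pairs). [cite: Milne1999, §3 p. 59 L5–L6; Prop. 3.5 p. 59] -/
theorem tKKToS_tKK : tKKToS p 𝔭 τ₀ h (tKK p 𝔭 τ₀ h) = constChar (cmNumbers ≃ₐ[ℚ] cmNumbers) (K →ₐ[ℚ] cmNumbers) cmNumbersConj 1 :=
  tSumKToS_single_tFamK p 𝔭 τ₀ h _

/-- **`l^K ↦ p^K`** (a map of pairs). [cite: Milne1999, §4 p. 62 L24–L27] -/
theorem lKKToP_lKK : lKKToP p 𝔭 τ₀ h (lKK p 𝔭 τ₀ h) = Additive.ofMul (pGermIn p τ₀) :=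
  lSumKToP_single_lFamK p 𝔭 τ₀ h _

/-- **`t^K ↦ l^K`** (a map of pairs). [cite: Milne1999, §5 Thm 5.4 p. 65; §6 p. 71 L22–L23] -/
theorem alphaKK_tKK : alphaKK p 𝔭 τ₀ h (tKK p 𝔭 τ₀ h) = lKK p 𝔭 τ₀ h := by
  change Submodule.Quotient.mk (alphaSumK p 𝔭 τ₀ h (Pi.single _ (tFamK p 𝔭 τ₀ h (Quotient.mk'' (CosetGerm.psiType h))))) = _
  rw [alphaSumK_single_tFamK]
  rfl

end PairElements

end CMNumbers

end Literature.NumberTheory.ComplexMultiplication
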